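import Mathlib
import HarnessLib
import Summits.NavierStokesRegularity.NavierStokesRegularity.Theorems.WakeRatchetMinimalViscousBlowupReignition
import Summits.NavierStokesRegularity.NavierStokesRegularity.Theorems.WakeRatchetMinimalViscousBlowupLevelGrowth

/-!
# Route `WakeRatchet`, crux `MinimalViscousBlowup` (stmt-NavierStokesRegularity-22743), LINE g11-1 «threshold ray» (skeleton v3.10
# ebed8644104749ae), stub S5b♭₂ `stub_retreatDepthAtThreshold` — the DARK-BLOCK LIFE BOUND («a deep retreat costs λ^{2d}»)

A CLOCK-FREE quantitative helper for the open rigidity stub `stub_retreatDepthAtThreshold` (bounded retreat depth (H2″)) — PLAN A of the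
line's STUB-PLAN-retreatDepthAtThreshold («cost of a deep retreat without a clock»), extracted from the landed implication
`retreatDepth_of_frontClock` ((FC′) ⇒ (H2″)) so that it can be composed with ANY upper bound on the remaining lifetime.  MODEL lattice only
(Tao's NS-scaled `ν`-viscous cascade lattice, `m = 4`); nothing here is a statement about the Navier–Stokes equations; no stub is closed by
name and no summit is proved by this file.

* `life_lower_of_dark_block` — along an enveloped blow-up at time `T` (the S4 binders of the skeleton: exact `ν`-viscous motion law, no shells
  below `0`, weight-10 regular on every `[0,T']`, blow-up at `T`, critical envelope `λⁿ‖X_n‖² ≤ C`), if at a time `s < T` EVERY shell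
  `n ≥ k` is dark (`λⁿ‖X_n(s)‖² ≤ ν²/(32768λ¹⁹)`), then the remaining lifetime is bounded BELOW by the depth of the dark block:
  `ν²/(32768λ¹⁹) < 256·C·√C·λ^{2k}·(T − s)`, i.e. `T − s > ν² λ^{−2k}/(2²³ λ¹⁹ C√C)`.  Proof: `reignition` (the tree's closed-valve maximum
  principle: shell `k` must exceed `ν²/(16384λ¹⁹)` again before `T`) and `level_growth_le` (doubling a level at shell `k` under the envelope
  takes time `≥ level·λ^{−2k}/(512C√C)`).
* `life_lower_of_retreat` — the same in the stub's «retreat» currency: if shell `m` has retreated by depth `d ≤ m` at time `s` (every shell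
  `n ≥ m − d` dark), then `ν²/(32768λ¹⁹)·λ^{2d} < 256·C·√C·λ^{2m}·(T − s)`: a retreat of depth `d` below shell `m` leaves a remaining life
  `≳ λ^{2d}·λ^{−2m}` — so ANY clock `(T − s)·λ^{2m} ≤ K` valid after shell `m` has fired (the fired front clock (FC′), or a weaker one) caps the
  retreat depth by `λ^{2d} < 2²³λ¹⁹ K C√C/ν²`; with (FC′) this is exactly the landed `retreatDepth_of_frontClock`.
What it does NOT give: a bound on `d` by itself — (H2″) as typed still needs an independent upper bound on the gaps of the threshold trajectory
(STUB-PLAN §«Why no mechanism is known»).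
[cite: Tao2016AveragedNS, §4 (4.1)–(4.3), Lemma 4.1 (4.5), §5; BarbatoMorandinRomito2011, §3.1]
-/

noncomputable section

set_option linter.dupNamespace false

open Set Filter Topology
open Literature.Analysis.FluidPDE Literature.Analysis.FluidPDE.TaoCascade

namespace Summit.NavierStokesRegularity.NavierStokesRegularity.Theorems.MinimalViscousBlowup.ThresholdRay

/-- **Dark-block life bound.**  Along an enveloped blow-up of the `ν`-viscous lattice at time `T` (S4 binders), if at a time `s < T` every
shell `n ≥ k` is dark (`λⁿ‖X_n(s)‖² ≤ ν²/(32768λ¹⁹)`), then `ν²/(32768λ¹⁹) < 256·C·√C·λ^{2k}·(T − s)`: the cascade needs a time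
`≳ λ^{−2k}` to re-light shell `k` (`reignition` + `level_growth_le`), and it must do so before the blow-up.  MODEL lattice only.
[cite: Tao2016AveragedNS, §4 (4.3), Lemma 4.1 (4.5), §5; BarbatoMorandinRomito2011, §3.1] -/
theorem life_lower_of_dark_block {ε₀ ν T C : ℝ} (hε : 0 < ε₀) (hν : 0 < ν) (hT : 0 < T)
    {α : Fin 4 → Fin 4 → Fin 4 → ℤ × ℤ × ℤ → ℝ} (hcan : IsCancellingCoeff α)
    (hα1 : ∀ i₁ i₂ i₃, |α i₁ i₂ i₃ (0, 0, 1)| ≤ 1) {X : Fin 4 → ℤ → ℝ → ℝ}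
    (hcd : ∀ i n, ContDiffOn ℝ 1 (X i n) (Ico 0 T))
    (hlow : ∀ i n t, n < 0 → X i n t = 0)
    (hmot : ∀ i n t, 0 ≤ t → t < T → derivWithin (X i n) (Ici 0) t =
      quadTerm ε₀ α X i n t - ν * (1 + ε₀) ^ ((2 : ℝ) * n) * X i n t)
    (hreg : ∀ T' : ℝ, 0 < T' → T' < T → ∃ M : ℝ, ∀ t : ℝ, 0 ≤ t → t ≤ T' →
      ∀ (i : Fin 4) (n : ℤ), (1 + (1 + ε₀) ^ ((10 : ℝ) * n)) * |X i n t| ≤ M)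
    (hblow : ∀ M : ℝ, ∃ t : ℝ, 0 ≤ t ∧ t < T ∧
      ∃ (i : Fin 4) (n : ℤ), M < (1 + (1 + ε₀) ^ ((10 : ℝ) * n)) * |X i n t|)
    (henv : ∀ (n : ℤ) (t : ℝ), 0 ≤ t → t < T → (1 + ε₀) ^ n * ‖shellVec X n t‖ ^ 2 ≤ C)
    {k : ℕ} {s : ℝ} (hs0 : 0 ≤ s) (hsT : s < T)
    (hdark : ∀ n : ℕ, k ≤ n → (1 + ε₀) ^ n * ‖shellVec X n s‖ ^ 2 ≤ 1 / (32768 * (1 + ε₀) ^ 19) * ν ^ 2) :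
    1 / (32768 * (1 + ε₀) ^ 19) * ν ^ 2 < 256 * C * Real.sqrt C * (1 + ε₀) ^ (2 * k) * (T - s) := by
  have hl0 : (0 : ℝ) < 1 + ε₀ := by linarith
  have hC0 : 0 ≤ C := le_trans (by positivity) (henv 0 0 le_rfl hT)
  have hlow' : ∀ i n t, n < 0 → 0 ≤ t → X i n t = 0 := fun i n t hn _ => hlow i n t hn
  -- the darkness constant `c = 1/(16384 λ¹⁹)`; the hypothesis level is `cν²/2`
  obtain ⟨c, hc⟩ : ∃ c : ℝ, c = 1 / (16384 * (1 + ε₀) ^ 19) := ⟨_, rfl⟩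
  have hc0 : 0 < c := by rw [hc]; positivity
  have hc1 : c ≤ 1 / (16384 * (1 + ε₀) ^ 19) := hc.le
  have hc2 : 1 / (32768 * (1 + ε₀) ^ 19) * ν ^ 2 = c / 2 * ν ^ 2 := by
    rw [hc]; field_simp; ring
  rw [hc2] at hdark ⊢
  -- shell `k` is dark and so is everything above it; it must re-ignite before `T`
  have hdark' : ∀ n : ℕ, k < n → (1 + ε₀) ^ n * ‖shellVec X n s‖ ^ 2 ≤ c / 2 * ν ^ 2 :=
    fun n hn => hdark n hn.le
  have hks : (1 + ε₀) ^ k * ‖shellVec X k s‖ ^ 2 ≤ c / 2 * ν ^ 2 := hdark k le_rfl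
  obtain ⟨t₁, hst₁, ht₁T, hfire⟩ :=
    reignition hε hν hT hcan hα1 hcd hlow hmot hreg hblow henv hc0 hc1 hs0 hsT hdark'
  -- rise time on the window `[s,t₁] ⊂ [0,T')`, `T' := (t₁+T)/2`
  set T' : ℝ := (t₁ + T) / 2 with hT'
  have ht₁T' : t₁ < T' := by rw [hT']; linarith
  have hT'T : T' < T := by rw [hT']; linarith
  have hder := hasDerivWithinAt_window_of_clauses (ε₀ := ε₀) (ν := ν) (α := α) hcd hmot hT'T
  have henv' : ∀ (m : ℕ) (τ : ℝ), τ ∈ Icc s t₁ → (1 + ε₀) ^ m * ‖shellVec X m τ‖ ^ 2 ≤ C := by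
    intro m τ hτ
    have := henv m τ (hs0.trans hτ.1) (lt_of_le_of_lt hτ.2 ht₁T)
    rwa [zpow_natCast] at this
  have hrise := level_growth_le hε hC0 hcan hα1 hder hlow' henv' hs0 hst₁ ht₁T' hν.le k
  -- `cν²/2 < 256 C√C λ^{2k} (t₁ - s) ≤ 256 C√C λ^{2k} (T - s)`
  have hCC : 0 ≤ 256 * C * Real.sqrt C * (1 + ε₀) ^ (2 * k) := by positivity
  have hmono : 256 * C * Real.sqrt C * (1 + ε₀) ^ (2 * k) * (t₁ - s)
      ≤ 256 * C * Real.sqrt C * (1 + ε₀) ^ (2 * k) * (T - s) :=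
    mul_le_mul_of_nonneg_left (by linarith) hCC
  linarith

/-- **A retreat of depth `d` costs `λ^{2d}` of remaining life.**  Along an enveloped blow-up (S4 binders), if at a time `s < T` every shell
`n ≥ m − d` is dark (`d ≤ m`: the lit set has retreated at least `d` shells below shell `m`), then
`ν²/(32768λ¹⁹)·λ^{2d} < 256·C·√C·λ^{2m}·(T − s)`.  Hence any clock `(T − s)·λ^{2m} ≤ K` available once shell `m` has fired bounds the
retreat depth by `λ^{2d} < 2²³λ¹⁹·K·C√C/ν²` (with the fired front clock (FC′) this is `retreatDepth_of_frontClock`).  MODEL lattice only.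
[cite: Tao2016AveragedNS, §4 (4.3), Lemma 4.1 (4.5), §5; BarbatoMorandinRomito2011, §3.1] -/
theorem life_lower_of_retreat {ε₀ ν T C : ℝ} (hε : 0 < ε₀) (hν : 0 < ν) (hT : 0 < T)
    {α : Fin 4 → Fin 4 → Fin 4 → ℤ × ℤ × ℤ → ℝ} (hcan : IsCancellingCoeff α)
    (hα1 : ∀ i₁ i₂ i₃, |α i₁ i₂ i₃ (0, 0, 1)| ≤ 1) {X : Fin 4 → ℤ → ℝ → ℝ}
    (hcd : ∀ i n, ContDiffOn ℝ 1 (X i n) (Ico 0 T))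
    (hlow : ∀ i n t, n < 0 → X i n t = 0)
    (hmot : ∀ i n t, 0 ≤ t → t < T → derivWithin (X i n) (Ici 0) t =
      quadTerm ε₀ α X i n t - ν * (1 + ε₀) ^ ((2 : ℝ) * n) * X i n t)
    (hreg : ∀ T' : ℝ, 0 < T' → T' < T → ∃ M : ℝ, ∀ t : ℝ, 0 ≤ t → t ≤ T' →
      ∀ (i : Fin 4) (n : ℤ), (1 + (1 + ε₀) ^ ((10 : ℝ) * n)) * |X i n t| ≤ M)
    (hblow : ∀ M : ℝ, ∃ t : ℝ, 0 ≤ t ∧ t < T ∧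
      ∃ (i : Fin 4) (n : ℤ), M < (1 + (1 + ε₀) ^ ((10 : ℝ) * n)) * |X i n t|)
    (henv : ∀ (n : ℤ) (t : ℝ), 0 ≤ t → t < T → (1 + ε₀) ^ n * ‖shellVec X n t‖ ^ 2 ≤ C)
    {m d : ℕ} (hdm : d ≤ m) {s : ℝ} (hs0 : 0 ≤ s) (hsT : s < T)
    (hdark : ∀ n : ℕ, m ≤ n + d → (1 + ε₀) ^ n * ‖shellVec X n s‖ ^ 2 ≤ 1 / (32768 * (1 + ε₀) ^ 19) * ν ^ 2) :
    1 / (32768 * (1 + ε₀) ^ 19) * ν ^ 2 * (1 + ε₀) ^ (2 * d)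
      < 256 * C * Real.sqrt C * (1 + ε₀) ^ (2 * m) * (T - s) := by
  have hl0 : (0 : ℝ) < 1 + ε₀ := by linarith
  obtain ⟨k, rfl⟩ := Nat.exists_eq_add_of_le hdm
  -- every shell `n ≥ k` is dark
  have hdark' : ∀ n : ℕ, k ≤ n → (1 + ε₀) ^ n * ‖shellVec X n s‖ ^ 2 ≤ 1 / (32768 * (1 + ε₀) ^ 19) * ν ^ 2 :=
    fun n hn => hdark n (by omega)
  have h := life_lower_of_dark_block hε hν hT hcan hα1 hcd hlow hmot hreg hblow henv hs0 hsT hdark'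
  have hP : 0 < (1 + ε₀) ^ (2 * d) := pow_pos hl0 _
  have hsplit : (1 + ε₀) ^ (2 * (d + k)) = (1 + ε₀) ^ (2 * k) * (1 + ε₀) ^ (2 * d) := by
    rw [← pow_add]; congr 1; ring
  calc 1 / (32768 * (1 + ε₀) ^ 19) * ν ^ 2 * (1 + ε₀) ^ (2 * d)
      < 256 * C * Real.sqrt C * (1 + ε₀) ^ (2 * k) * (T - s) * (1 + ε₀) ^ (2 * d) :=
        mul_lt_mul_of_pos_right h hP
    _ = 256 * C * Real.sqrt C * (1 + ε₀) ^ (2 * (d + k)) * (T - s) := by rw [hsplit]; ring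

end Summit.NavierStokesRegularity.NavierStokesRegularity.Theorems.MinimalViscousBlowup.ThresholdRay

end
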